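import Literature.NumberTheory.Automorphic.EssConjSelfDual
import Literature.NumberTheory.Automorphic.ArchParameterTwistNorm
import HarnessLib

/-!
# Essential (conjugate) self-duality is transported along the twist `π ⊗ |det|_𝔸^s`
# (pure proofs)

Topic `NumberTheory/Automorphic`; theorems only (no definition, no named fact). Companion of
`EssConjSelfDual` (the pairing form `IsGalConjEssSelfDual π σ χ` of `π^σ ≅ π^∨ ⊗ (χ ∘ det)`,
Fakhruddin–Pilloni §9.1, BLGGT §2.1) and of `AutomorphicTwistNorm` / `ArchParameterTwistNorm`
(the Borel–Jacquet twist `π' = π ⊗ |det|_𝔸^s`: `π'.W = c · W`, `π'.W' = c · W'` for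
`c = ‖·‖^s ∘ det`, with `W / W' ≃ W·c / W'·c` and the Lie algebra acting on the twist by
`X ↦ X + s λ(X)`).

**Result** (`AutomorphicRepData.IsGalConjEssSelfDual.of_map_mulChar_detTwist_of_cpow`): if
`π^σ ≅ π^∨ ⊗ (χ ∘ det)` in the pairing form and `π' = π ⊗ (ψ ∘ det)` with `ψ = ‖·‖_𝔸^s`, then
`π'^σ ≅ π'^∨ ⊗ (χ' ∘ det)` for every Hecke character `χ'` with
`χ'(det g) = χ(det g) ψ(det g) ψ(det σg)` on `GL_n(𝔸_K)` — the elementary identity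
`(π ⊗ ψ)^σ = π^σ ⊗ ψ^σ ≅ π^∨ ⊗ χ ψ^σ = (π ⊗ ψ)^∨ ⊗ χ ψ ψ^σ` (Fakhruddin–Pilloni, §9.1.2: "if `π`
is essentially conjugate self dual, there exists an algebraic Hecke character `ψ` such that
`π ⊗ ψ` is conjugate self dual"; Barnet-Lamb–Gee–Geraghty–Taylor, §2.1, before Thm. 2.1.1:
`(π, χ) ↦ (π ⊗ (ψ ∘ det), χ ψ ψ^c)`). The transported pairing is
`B'(x', y') = B(e⁻¹ x', e⁻¹ y')` for the quotient isomorphism `e : W / W' ≃ W·c / W'·c`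
(`exists_quotEquiv_of_map_mulChar`); the three clauses follow from
`r(h)(c φ) = c(h) · c · r(h) φ` (`rightTranslation_mulChar`) on `G(𝔸_f)` and `K_∞`, and from
`X (c φ) = c (X φ + s λ(X) φ)` (`lieDeriv_mulChar_detTwist_of_cpow`) on `𝔤`, the differential of
`χ' ∘ det` along `exp tX` being that of `χ ∘ det` plus `s λ(X) + s λ(X')` when
`exp tX' = σ · exp tX` (`detTwist_ofArch_expMem_of_cpow`).

The identity hypothesis `hχ'` is pointwise on `GL_n(𝔸_K)`; instantiating it (e.g. `χ' = 1` for
`χ = ‖·‖^m`, `s = -m/2`, using `‖det σg‖ = ‖det g‖`) is left to the user.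

## Contents

* `AutomorphicRepData.finiteRep_quotEquiv_of_map_mulChar`,
  `AutomorphicRepData.kRep_quotEquiv_of_map_mulChar` — `π'(h) (e x) = c(h) · e (π(h) x)` on
  `G(𝔸_f)` and on `K_∞`.
* `AutomorphicRepData.lieDerivW_mulChar_of_cpow` — `X (c φ) = c (X φ + s λ(X) φ)` in `π'.W`.
* `hasDerivAt_mul_cexp_neg`, `hasDerivAt_of_eq_mul_cexp_mul_cexp` — calculus helpers
  (`(f e^{-ta})'(0) = f'(0) - f(0) a`; `f = g e^{ta} e^{ta'}`, `f(0) = 1` ⇒ `g'(0) = f'(0) - a - a'`).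
* `AutomorphicRepData.IsGalConjEssSelfDual.of_map_mulChar_detTwist_of_cpow` — the result.

## References

* N. Fakhruddin, V. Pilloni, J. Inst. Math. Jussieu 22 (2023) = arXiv:1910.03790, §9.1, §9.1.2.
  [FakhruddinPilloni2021]
* T. Barnet-Lamb, T. Gee, D. Geraghty, R. Taylor, Ann. of Math. 179 (2014), §2.1.
  [BarnetlambEtAl2014]
* A. Borel, H. Jacquet, Corvallis 1979, §4.6, 5.7. [BorelJacquet1979]
-/

noncomputable section

-- (H5) `Classical`: the place subtypes indexing `mixedSpace K` are `Fintype` classically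
open scoped MatrixGroups Classical
open NumberField NumberField.mixedEmbedding IsDedekindDomain

namespace Literature.NumberTheory.Automorphic

open Literature.NumberTheory.GaloisRepresentations (HeckeCharacter ideleGroup)

/-! ### A calculus helper -/

/-- `(f(t) e^{-ta})'(0) = f'(0) - f(0) a` for `f : ℝ → ℂ`. [folklore] -/
theorem hasDerivAt_mul_cexp_neg {f : ℝ → ℂ} {d : ℂ} (hf : HasDerivAt f d 0) (a : ℂ) :
    HasDerivAt (fun t : ℝ => f t * Complex.exp (-((t : ℂ) * a))) (d - f 0 * a) 0 := by
  have h0 : HasDerivAt (fun t : ℝ => (t : ℂ)) 1 0 := by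
    simpa using (hasDerivAt_id (0 : ℝ)).ofReal_comp
  have h1 : HasDerivAt (fun t : ℝ => Complex.exp (-((t : ℂ) * a))) (-a) 0 := by
    refine ((h0.mul_const a).neg.cexp).congr_deriv ?_
    simp only [Pi.neg_apply, Complex.ofReal_zero, zero_mul, neg_zero, Complex.exp_zero, one_mul]
  refine (hf.mul h1).congr_deriv ?_
  simp only [Complex.ofReal_zero, zero_mul, neg_zero, Complex.exp_zero, mul_one, mul_neg,
    sub_eq_add_neg]

/-- If `f(t) = g(t) e^{ta} e^{ta'}`, `f'(0) = d` and `f(0) = 1`, then `g'(0) = d - a - a'`. [folklore] -/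
theorem hasDerivAt_of_eq_mul_cexp_mul_cexp {f g : ℝ → ℂ} {a a' d : ℂ}
    (hfg : ∀ t : ℝ, f t = g t * Complex.exp ((t : ℂ) * a) * Complex.exp ((t : ℂ) * a'))
    (hf : HasDerivAt f d 0) (hf0 : f 0 = 1) : HasDerivAt g (d - a - a') 0 := by
  have hg : g = fun t : ℝ => f t * Complex.exp (-((t : ℂ) * a)) * Complex.exp (-((t : ℂ) * a')) := by
    funext t
    calc g t = g t * (Complex.exp ((t : ℂ) * a) * Complex.exp (-((t : ℂ) * a))) *
          (Complex.exp ((t : ℂ) * a') * Complex.exp (-((t : ℂ) * a'))) := by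
            rw [← Complex.exp_add, ← Complex.exp_add, add_neg_cancel, add_neg_cancel,
              Complex.exp_zero, mul_one, mul_one]
      _ = f t * Complex.exp (-((t : ℂ) * a)) * Complex.exp (-((t : ℂ) * a')) := by
            rw [hfg t]; ring
  have h := hasDerivAt_mul_cexp_neg (hasDerivAt_mul_cexp_neg hf a) a'
  rw [hg]
  refine h.congr_deriv ?_
  simp only [hf0, Complex.ofReal_zero, zero_mul, neg_zero, Complex.exp_zero, mul_one, one_mul]

namespace AutomorphicRepData

variable {n : ℕ} {K : Type} [Field K] [NumberField K] {hcpt : isCompact_glFiniteIntegralLevel n K}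

/-! ### Transport of the `G(𝔸_f)`- and `K_∞`-actions along `W / W' ≃ W·c / W'·c` -/

/-- **`π'(h) (e x) = c(h) · e (π(h) x)` on `G(𝔸_f)`**: along the quotient isomorphism
`e : W / W' ≃ W·c / W'·c` (`exists_quotEquiv_of_map_mulChar`), right translation on the twist
is right translation times `c(h)` (`rightTranslation_mulChar`). Borel–Jacquet 1979, 4.6, 5.7.
[cite: BorelJacquet1979, 5.7] -/
theorem finiteRep_quotEquiv_of_map_mulChar (c : (AdelicGroupData.gl n K).Adelic →* ℂˣ)
    {π π' : AutomorphicRepData (AutomorphyDatum.gl n K hcpt)}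
    (hW : π'.W = π.W.map (mulChar c)) {e : π.Quot ≃ₗ[ℂ] π'.Quot}
    (he : ∀ φ : π.W, e (π.mkQ φ) = π'.mkQ ⟨mulChar c φ, hW ▸ Submodule.mem_map_of_mem φ.2⟩)
    (h : (AutomorphyDatum.gl n K hcpt).finiteAdelic) (x : π.Quot) :
    π'.finiteRep h (e x) =
      ((c (h : (AdelicGroupData.gl n K).Adelic) : ℂˣ) : ℂ) • e (π.finiteRep h x) := by
  induction x using Submodule.Quotient.induction_on with
  | H φ =>
  have hmk : (Submodule.Quotient.mk φ : π.Quot) = π.mkQ φ := rfl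
  have hmem : ∀ ψ : π.W, mulChar c (ψ : (AdelicGroupData.gl n K).Adelic → ℂ) ∈ π'.W := fun ψ =>
    hW ▸ Submodule.mem_map_of_mem ψ.2
  have h1 : π'.finiteRepW h ⟨mulChar c φ, hmem φ⟩ =
      ((c (h : (AdelicGroupData.gl n K).Adelic) : ℂˣ) : ℂ) • ⟨mulChar c (π.finiteRepW h φ),
        hmem (π.finiteRepW h φ)⟩ :=
    Subtype.ext (rightTranslation_mulChar _ c _ _)
  have h2 : π.finiteRep h (π.mkQ φ) = π.mkQ (π.finiteRepW h φ) := rfl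
  rw [hmk, he, h2, he (π.finiteRepW h φ)]
  change π'.mkQ (π'.finiteRepW h ⟨mulChar c φ, hmem φ⟩) = _
  rw [h1, map_smul]

/-- **`π'(k) (e x) = c(k) · e (π(k) x)` on `K_∞`** (same argument with `𝒟.ofK k`).
[cite: BorelJacquet1979, 5.7] -/
theorem kRep_quotEquiv_of_map_mulChar (c : (AdelicGroupData.gl n K).Adelic →* ℂˣ)
    {π π' : AutomorphicRepData (AutomorphyDatum.gl n K hcpt)}
    (hW : π'.W = π.W.map (mulChar c)) {e : π.Quot ≃ₗ[ℂ] π'.Quot}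
    (he : ∀ φ : π.W, e (π.mkQ φ) = π'.mkQ ⟨mulChar c φ, hW ▸ Submodule.mem_map_of_mem φ.2⟩)
    (k : (AutomorphyDatum.gl n K hcpt).arch.maximalCompact) (x : π.Quot) :
    π'.kRep k (e x) =
      ((c ((AutomorphyDatum.gl n K hcpt).ofK k) : ℂˣ) : ℂ) • e (π.kRep k x) := by
  induction x using Submodule.Quotient.induction_on with
  | H φ =>
  have hmk : (Submodule.Quotient.mk φ : π.Quot) = π.mkQ φ := rfl
  have hmem : ∀ ψ : π.W, mulChar c (ψ : (AdelicGroupData.gl n K).Adelic → ℂ) ∈ π'.W := fun ψ =>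
    hW ▸ Submodule.mem_map_of_mem ψ.2
  have h1 : π'.kRepW k ⟨mulChar c φ, hmem φ⟩ =
      ((c ((AutomorphyDatum.gl n K hcpt).ofK k) : ℂˣ) : ℂ) • ⟨mulChar c (π.kRepW k φ),
        hmem (π.kRepW k φ)⟩ :=
    Subtype.ext (rightTranslation_mulChar _ c _ _)
  have h2 : π.kRep k (π.mkQ φ) = π.mkQ (π.kRepW k φ) := rfl
  rw [hmk, he, h2, he (π.kRepW k φ)]
  change π'.mkQ (π'.kRepW k ⟨mulChar c φ, hmem φ⟩) = _
  rw [h1, map_smul]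

/-- **`X (c φ) = c (X φ + s λ(X) φ)` in `π'.W`** for `c = ‖·‖^s ∘ det`
(`lieDeriv_mulChar_detTwist_of_cpow`, as an identity of elements of `π'.W`).
[cite: BorelJacquet1979, 5.7] -/
theorem lieDerivW_mulChar_of_cpow {χ : HeckeCharacter K} {s : ℂ}
    (hχ : ∀ x : ideleGroup K, ((χ x : ℂˣ) : ℂ) = (GaloisRepresentations.ideleNorm x : ℂ) ^ s)
    {lam : (AutomorphyDatum.gl n K hcpt).arch.lie →ₗ[ℝ] ℝ}
    (hlam : ∀ X : (AutomorphyDatum.gl n K hcpt).arch.lie,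
      lam X = (∑ w, (X : Matrix (Fin n) (Fin n) (mixedSpace K)).trace.1 w) +
        ∑ w, 2 * ((X : Matrix (Fin n) (Fin n) (mixedSpace K)).trace.2 w).re)
    {π π' : AutomorphicRepData (AutomorphyDatum.gl n K hcpt)}
    (hW : π'.W = π.W.map (mulChar (detTwist n χ)))
    (X : (AutomorphyDatum.gl n K hcpt).arch.lie) (φ : π.W) :
    π'.lieDerivW X ⟨mulChar (detTwist n χ) φ, hW ▸ Submodule.mem_map_of_mem φ.2⟩ =
      ⟨mulChar (detTwist n χ) ((π.lieDerivW X φ + (s * (lam X : ℂ)) • φ : π.W) :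
          (AdelicGroupData.gl n K).Adelic → ℂ),
        hW ▸ Submodule.mem_map_of_mem (π.lieDerivW X φ + (s * (lam X : ℂ)) • φ).2⟩ :=
  Subtype.ext (lieDeriv_mulChar_detTwist_of_cpow hχ hlam π X φ)

/-! ### The transport of essential `σ`-conjugate self-duality -/

set_option maxHeartbeats 1600000 in
-- the five clauses are elaborated in one declaration (each is cheap; the sum is not)
/-- **Twisting by `|det|_𝔸^s` transports essential `σ`-conjugate self-duality**
(Fakhruddin–Pilloni §9.1.2; BLGGT §2.1: `(π, χ) ↦ (π ⊗ ψ∘det, χ ψ ψ^σ)`). Let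
`π^σ ≅ π^∨ ⊗ (χ ∘ det)` in the pairing form (`IsGalConjEssSelfDual π σ χ`), let `ψ = ‖·‖_𝔸^s`
and let `π'` be the twisted datum (`π'.W = (ψ∘det) · W`, `π'.W' = (ψ∘det) · W'`). Then
`π'^σ ≅ π'^∨ ⊗ (χ' ∘ det)` for every Hecke character `χ'` with
`χ'(det g) = χ(det g) ψ(det g) ψ(det σg)` on `GL_n(𝔸_K)`: the pairing
`B'(x', y') = B(e⁻¹x', e⁻¹y')` works, by `π'(h)(e x) = ψ(det h) e(π(h) x)` on `G(𝔸_f)` and `K_∞`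
and `X(cφ) = c(Xφ + sλ(X)φ)` on `𝔤` (the differential of `χ'∘det` along `exp tX` is that of
`χ∘det` plus `sλ(X) + sλ(X')` when `exp tX' = σ exp tX`).
[cite: FakhruddinPilloni2021, §9.1.2] [cite: BarnetlambEtAl2014, §2.1] -/
theorem IsGalConjEssSelfDual.of_map_mulChar_detTwist_of_cpow {F : Type*} [Field F] [Algebra F K]
    {σ : K ≃ₐ[F] K} {χ χ' ψ : HeckeCharacter K} {s : ℂ}
    (hψ : ∀ x : ideleGroup K, ((ψ x : ℂˣ) : ℂ) = (GaloisRepresentations.ideleNorm x : ℂ) ^ s)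
    {π π' : AutomorphicRepData (AutomorphyDatum.gl n K hcpt)}
    (hW : π'.W = π.W.map (mulChar (detTwist n ψ)))
    (hW' : π'.W' = π.W'.map (mulChar (detTwist n ψ)))
    (h : π.IsGalConjEssSelfDual σ χ)
    (hχ' : ∀ g : (AdelicGroupData.gl n K).Adelic,
      ((detTwist n χ' g : ℂˣ) : ℂ) =
        ((detTwist n χ g : ℂˣ) : ℂ) * ((detTwist n ψ g : ℂˣ) : ℂ) *
          ((detTwist n ψ (σ • g) : ℂˣ) : ℂ)) :
    π'.IsGalConjEssSelfDual σ χ' := by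
  classical
  set c := detTwist n ψ with hc
  obtain ⟨B, hBl, hBr, hBf, hBk, hBg⟩ := h
  obtain ⟨e, he⟩ := exists_quotEquiv_of_map_mulChar c hW hW'
  obtain ⟨lam, -, hlam⟩ := exists_normExponent (n := n) (K := K) hcpt
  have hmem : ∀ φ : π.W, mulChar c (φ : (AdelicGroupData.gl n K).Adelic → ℂ) ∈ π'.W := fun φ =>
    hW ▸ Submodule.mem_map_of_mem φ.2
  -- the transported pairing
  let B' : π'.Quot →ₗ[ℂ] π'.Quot →ₗ[ℂ] ℂ :=
    B.compl₁₂ (e.symm : π'.Quot →ₗ[ℂ] π.Quot) (e.symm : π'.Quot →ₗ[ℂ] π.Quot)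
  have hB' : ∀ x y : π.Quot, B' (e x) (e y) = B x y := fun x y => by
    simp only [B', LinearMap.compl₁₂_apply, LinearEquiv.coe_coe, LinearEquiv.symm_apply_apply]
  -- `c` along one-parameter subgroups: `c (exp Y, 1) = e^{s λ(Y)}`
  have hcexp : ∀ Y : (AutomorphyDatum.gl n K hcpt).arch.lie,
      ((c ((AutomorphyDatum.gl n K hcpt).ofArch ((AutomorphyDatum.gl n K hcpt).arch.expMem Y)) :
        ℂˣ) : ℂ) = Complex.exp (s * (lam Y : ℂ)) := fun Y => by
    rw [hc, detTwist_ofArch_expMem_of_cpow hψ, ← hlam Y]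
  refine ⟨B', ?_, ?_, ?_, ?_, ?_⟩
  · -- left non-degeneracy
    intro x' hx'
    have hx : e.symm x' ≠ 0 := fun h0 => hx' (by simpa using congrArg e h0)
    obtain ⟨y, hy⟩ := hBl _ hx
    refine ⟨e y, ?_⟩
    simpa only [B', LinearMap.compl₁₂_apply, LinearEquiv.coe_coe, LinearEquiv.symm_apply_apply]
      using hy
  · -- right non-degeneracy
    intro y' hy'
    have hy : e.symm y' ≠ 0 := fun h0 => hy' (by simpa using congrArg e h0)
    obtain ⟨x, hx⟩ := hBr _ hy
    refine ⟨e x, ?_⟩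
    simpa only [B', LinearMap.compl₁₂_apply, LinearEquiv.coe_coe, LinearEquiv.symm_apply_apply]
      using hx
  · -- `G(𝔸_f)`-clause
    intro g hg hσg x' y'
    obtain ⟨x, rfl⟩ := e.surjective x'
    obtain ⟨y, rfl⟩ := e.surjective y'
    have h1 := finiteRep_quotEquiv_of_map_mulChar c hW he ⟨σ • g, hσg⟩ x
    have h2 := finiteRep_quotEquiv_of_map_mulChar c hW he ⟨g, hg⟩ y
    rw [h1, h2, LinearMap.map_smul₂, LinearMap.map_smul, hB', hBf g hg hσg x y, hB', hχ' g,
      smul_eq_mul, smul_eq_mul]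
    change ((c (σ • g) : ℂˣ) : ℂ) * (((c g : ℂˣ) : ℂ) * (((detTwist n χ g : ℂˣ) : ℂ) * B x y)) = _
    ring
  · -- `K_∞`-clause
    intro k k' hkk' x' y'
    obtain ⟨x, rfl⟩ := e.surjective x'
    obtain ⟨y, rfl⟩ := e.surjective y'
    have h1 := kRep_quotEquiv_of_map_mulChar c hW he k' x
    have h2 := kRep_quotEquiv_of_map_mulChar c hW he k y
    rw [h1, h2, LinearMap.map_smul₂, LinearMap.map_smul, hB', hBk k k' hkk' x y, hB',
      hχ' ((AutomorphyDatum.gl n K hcpt).ofK k), hkk', smul_eq_mul, smul_eq_mul]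
    ring
  · -- `𝔤`-clause
    intro X X' hXX' d' hd' ψ' φ'
    -- write `ψ' = c ψ₀`, `φ' = c φ₀`
    obtain ⟨ψ₀f, hψ₀, hψ₀'⟩ := Submodule.mem_map.1 (hW ▸ ψ'.2 :
      (ψ' : (AdelicGroupData.gl n K).Adelic → ℂ) ∈ π.W.map (mulChar c))
    obtain ⟨φ₀f, hφ₀, hφ₀'⟩ := Submodule.mem_map.1 (hW ▸ φ'.2 :
      (φ' : (AdelicGroupData.gl n K).Adelic → ℂ) ∈ π.W.map (mulChar c))
    set ψ₀ : π.W := ⟨ψ₀f, hψ₀⟩ with hψ₀def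
    set φ₀ : π.W := ⟨φ₀f, hφ₀⟩ with hφ₀def
    have eψ : ψ' = ⟨mulChar c ψ₀, hmem ψ₀⟩ := Subtype.ext hψ₀'.symm
    have eφ : φ' = ⟨mulChar c φ₀, hmem φ₀⟩ := Subtype.ext hφ₀'.symm
    -- the Lie derivatives on the twist, read in `W / W'`
    have hLX' : π'.mkQ (π'.lieDerivW X' ψ') =
        e (π.mkQ (π.lieDerivW X' ψ₀ + (s * (lam X' : ℂ)) • ψ₀)) := by
      rw [eψ, lieDerivW_mulChar_of_cpow hψ hlam hW X' ψ₀, he]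
    have hLX : π'.mkQ (π'.lieDerivW X φ') =
        e (π.mkQ (π.lieDerivW X φ₀ + (s * (lam X : ℂ)) • φ₀)) := by
      rw [eφ, lieDerivW_mulChar_of_cpow hψ hlam hW X φ₀, he]
    have hψq : π'.mkQ ψ' = e (π.mkQ ψ₀) := by rw [eψ, he]
    have hφq : π'.mkQ φ' = e (π.mkQ φ₀) := by rw [eφ, he]
    -- `c` along `exp tX` and along `σ • exp tX = exp tX'`
    have hcX : ∀ t : ℝ, ((c ((AutomorphyDatum.gl n K hcpt).ofArch
        ((AutomorphyDatum.gl n K hcpt).arch.expMem (t • X))) : ℂˣ) : ℂ) =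
          Complex.exp ((t : ℂ) * (s * (lam X : ℂ))) := fun t => by
      rw [hcexp, lam.map_smul, smul_eq_mul]
      push_cast
      ring_nf
    have hcX' : ∀ t : ℝ, ((c (σ • (AutomorphyDatum.gl n K hcpt).ofArch
        ((AutomorphyDatum.gl n K hcpt).arch.expMem (t • X))) : ℂˣ) : ℂ) =
          Complex.exp ((t : ℂ) * (s * (lam X' : ℂ))) := fun t => by
      rw [← hXX' t, hcexp, lam.map_smul, smul_eq_mul]
      push_cast
      ring_nf
    -- the differential of `χ ∘ det` along `exp tX` is `d' - sλ(X) - sλ(X')`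
    have hf0 : ((detTwist n χ' ((AutomorphyDatum.gl n K hcpt).ofArch
        ((AutomorphyDatum.gl n K hcpt).arch.expMem ((0 : ℝ) • X))) : ℂˣ) : ℂ) = 1 := by
      rw [zero_smul, RealMatrixGroup.expMem_zero', map_one, map_one, Units.val_one]
    have hdg : HasDerivAt (fun t : ℝ => ((detTwist n χ ((AutomorphyDatum.gl n K hcpt).ofArch
        ((AutomorphyDatum.gl n K hcpt).arch.expMem (t • X))) : ℂˣ) : ℂ))
        (d' - s * (lam X : ℂ) - s * (lam X' : ℂ)) 0 :=
      hasDerivAt_of_eq_mul_cexp_mul_cexp (fun t => by rw [hχ', hcX t, hcX' t]) hd' hf0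
    -- apply the `𝔤`-clause of `π`
    have hπ := hBg X X' hXX' _ hdg ψ₀ φ₀
    rw [hLX', hLX, hψq, hφq, hB', hB', hB']
    simp only [map_add, map_smul, LinearMap.add_apply, LinearMap.smul_apply, smul_eq_mul]
    -- B(X'ψ₀,φ₀) + sλ(X') B(ψ₀,φ₀) + (B(ψ₀,Xφ₀) + sλ(X) B(ψ₀,φ₀)) = d' B(ψ₀,φ₀)
    linear_combination hπ

end AutomorphicRepData

end Literature.NumberTheory.Automorphic
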